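import Summits.ResolutionOfSingularities.ResolutionOfSingularities.Theorems.FrobeniusLadderFInjectiveMacaulayficationLineCentreEngine
import Summits.ResolutionOfSingularities.ResolutionOfSingularities.Theorems.FrobeniusLadderFInjectiveMacaulayficationAS3PinchPoly
import HarnessLib

/-!
# #4β for the characteristic-3 pinch `y³ + ut²y + ut³` along its singular line (second specimen of the line-centre engine)
# (crux `FInjectiveMacaulayfication` stmt-ResolutionOfSingularities-15315, chain w45a, door v30, line WFix under #4β)

[OURS · L1 W4.5a · res-L1-w45a-lead-1 gen 5] Support file (`--supports stmt-ResolutionOfSingularities-15315 --as helper`); NOT a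
statement of any manuscript; AI-written, weaker than expert review.

`X₁ = Spec k[y,u,t]/(y³ + ut²y + ut³)`, `char k = 3`, centre `J = (ȳ, t̄)~` (the reduced singular line). The chart certificates:
chart `y` is the regular surface `1 + uT² + uT³` (`∂/∂T = 2uT`, and `u`, `T` are units along it), chart `t` is the regular surface
`S³ + uS + u` (`∂/∂u = S + 1`, a unit along it since `S³ = g₁ − u(S+1)`); off `V(y,t)` the surface is regular (`∂f/∂y = ut²` where
`u ≠ 0`, `∂f/∂u = t²y + t³` where `u = 0`). Fed to `LineCentreEngine.closedCentreExists_of_charts(_bad)`: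
`closedCentreExists_AS3` / `closedCentreExists_AS3_bad` — the conclusion of door v30's `stub_closedCentreExists` for this `X₁` at every
point of `V(ȳ, t̄)`, resp. at every closed bad point. [folklore mathematics; OURS as a certificate]
-/

-- single-problem summit: the doubled namespace component is forced
set_option linter.dupNamespace false

noncomputable section

namespace Summit.ResolutionOfSingularities.ResolutionOfSingularities.Theorems.FInjectiveMacaulayfication.AS3Pinch

open AlgebraicGeometry CategoryTheory Literature.AlgebraicGeometry.Resolution MvPolynomial
open Summit.ResolutionOfSingularities.ResolutionOfSingularities.Theorems.FInjectiveMacaulayfication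
open Summit.ResolutionOfSingularities.ResolutionOfSingularities.Theorems.FInjectiveMacaulayfication.WildPinchClosedCentre

/-! ## §1 The chart certificates (on) -/

/-- The element `g` lies in every ideal pulled back from `k[X]/(g)`. -/
theorem self_mem_comap {k : Type} [Field k] (g : MvPolynomial (Fin 3) k) (P : Ideal (MvPolynomial (Fin 3) k ⧸ Ideal.span {g})) :
    g ∈ P.comap (Ideal.Quotient.mk (Ideal.span {g})) := by
  rw [Ideal.mem_comap, Ideal.Quotient.eq_zero_iff_mem.mpr (Ideal.mem_span_singleton_self g)]
  exact zero_mem _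

/-- **Chart `y`: `k[u,T,y]/(1 + uT² + uT³)` satisfies the clause at every maximal ideal** (`∂/∂T = 2uT` with `2`, `u`, `T` units modulo
every prime: `1 = g₀ − u(T² + T³) = g₀ − T(uT + uT²)`, `2·2 = 1`). [folklore] -/
theorem hon₀ (k : Type) [Field k] [CharP k 3]
    (Q' : Ideal (MvPolynomial (Fin 3) k ⧸ Ideal.span {(1 + X 1 * X 2 ^ 2 + X 1 * X 2 ^ 3 : MvPolynomial (Fin 3) k)})) [Q'.IsMaximal] :
    ∀ d : ℕ, ringKrullDim (Localization.AtPrime Q') = d → ∀ s : Fin d → Localization.AtPrime Q',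
      (Ideal.span (Set.range s)).radical.IsMaximal →
        RingTheory.Sequence.IsWeaklyRegular (Localization.AtPrime Q') (List.ofFn s) ∧
        ∀ y : Localization.AtPrime Q', (∃ e : ℕ, y ^ 3 ^ e ∈ Ideal.span
          ((fun z : Localization.AtPrime Q' => z ^ 3 ^ e) ''
            (Ideal.span (Set.range s) : Set (Localization.AtPrime Q')))) → y ∈ Ideal.span (Set.range s) := by
  haveI : Fact (Nat.Prime 3) := ⟨Nat.prime_three⟩
  refine ClauseOfPderivNotMem.stub_clauseOfPderivNotMem 3 k 3 _ Q' 2 ?_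
  rw [pderiv_two_g0 k]
  intro h
  have hP : (Q'.comap (Ideal.Quotient.mk (Ideal.span {(1 + X 1 * X 2 ^ 2 + X 1 * X 2 ^ 3 : MvPolynomial (Fin 3) k)}))).IsPrime :=
    Ideal.comap_isPrime _ _
  have hg := self_mem_comap (1 + X 1 * X 2 ^ 2 + X 1 * X 2 ^ 3 : MvPolynomial (Fin 3) k) Q'
  have hX1 : (X 1 : MvPolynomial (Fin 3) k) ∉
      Q'.comap (Ideal.Quotient.mk (Ideal.span {(1 + X 1 * X 2 ^ 2 + X 1 * X 2 ^ 3 : MvPolynomial (Fin 3) k)})) := by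
    intro h1
    have hmem := sub_mem hg (Ideal.mul_mem_right (X 2 ^ 2 + X 2 ^ 3) _ h1)
    rw [show (1 + X 1 * X 2 ^ 2 + X 1 * X 2 ^ 3 : MvPolynomial (Fin 3) k) - X 1 * (X 2 ^ 2 + X 2 ^ 3) = 1 by ring] at hmem
    exact hP.ne_top ((Ideal.eq_top_iff_one _).mpr hmem)
  have hX2 : (X 2 : MvPolynomial (Fin 3) k) ∉
      Q'.comap (Ideal.Quotient.mk (Ideal.span {(1 + X 1 * X 2 ^ 2 + X 1 * X 2 ^ 3 : MvPolynomial (Fin 3) k)})) := by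
    intro h2
    have hmem := sub_mem hg (Ideal.mul_mem_right (X 1 * X 2 + X 1 * X 2 ^ 2) _ h2)
    rw [show (1 + X 1 * X 2 ^ 2 + X 1 * X 2 ^ 3 : MvPolynomial (Fin 3) k) - X 2 * (X 1 * X 2 + X 1 * X 2 ^ 2) = 1 by ring] at hmem
    exact hP.ne_top ((Ideal.eq_top_iff_one _).mpr hmem)
  have htwo : (2 : MvPolynomial (Fin 3) k) ∉
      Q'.comap (Ideal.Quotient.mk (Ideal.span {(1 + X 1 * X 2 ^ 2 + X 1 * X 2 ^ 3 : MvPolynomial (Fin 3) k)})) := by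
    intro h2
    have hmem := Ideal.mul_mem_right (2 : MvPolynomial (Fin 3) k) _ h2
    rw [(three_eq_zero k).2] at hmem
    exact hP.ne_top ((Ideal.eq_top_iff_one _).mpr hmem)
  rcases hP.mem_or_mem h with h2 | h12
  · exact htwo h2
  · rcases hP.mem_or_mem h12 with h1 | h2
    · exact hX1 h1
    · exact hX2 h2

/-- **Chart `t`: `k[S,u,t]/(S³ + uS + u)` satisfies the clause at every maximal ideal** (`∂/∂u = S + 1`, a unit modulo every prime:
`S³ = g₁ − u(S + 1)`). [folklore] -/
theorem hon₁ (k : Type) [Field k] [CharP k 3]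
    (Q' : Ideal (MvPolynomial (Fin 3) k ⧸ Ideal.span {(X 0 ^ 3 + X 1 * X 0 + X 1 : MvPolynomial (Fin 3) k)})) [Q'.IsMaximal] :
    ∀ d : ℕ, ringKrullDim (Localization.AtPrime Q') = d → ∀ s : Fin d → Localization.AtPrime Q',
      (Ideal.span (Set.range s)).radical.IsMaximal →
        RingTheory.Sequence.IsWeaklyRegular (Localization.AtPrime Q') (List.ofFn s) ∧
        ∀ y : Localization.AtPrime Q', (∃ e : ℕ, y ^ 3 ^ e ∈ Ideal.span
          ((fun z : Localization.AtPrime Q' => z ^ 3 ^ e) ''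
            (Ideal.span (Set.range s) : Set (Localization.AtPrime Q')))) → y ∈ Ideal.span (Set.range s) := by
  haveI : Fact (Nat.Prime 3) := ⟨Nat.prime_three⟩
  refine ClauseOfPderivNotMem.stub_clauseOfPderivNotMem 3 k 3 _ Q' 1 ?_
  rw [pderiv_one_g1 k]
  intro h
  have hP : (Q'.comap (Ideal.Quotient.mk (Ideal.span {(X 0 ^ 3 + X 1 * X 0 + X 1 : MvPolynomial (Fin 3) k)}))).IsPrime :=
    Ideal.comap_isPrime _ _
  have hg := self_mem_comap (X 0 ^ 3 + X 1 * X 0 + X 1 : MvPolynomial (Fin 3) k) Q'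
  have hX0 : (X 0 : MvPolynomial (Fin 3) k) ∈
      Q'.comap (Ideal.Quotient.mk (Ideal.span {(X 0 ^ 3 + X 1 * X 0 + X 1 : MvPolynomial (Fin 3) k)})) := by
    refine hP.mem_of_pow_mem 3 ?_
    have hmem := sub_mem hg (Ideal.mul_mem_left _ (X 1) h)
    rwa [show (X 0 ^ 3 + X 1 * X 0 + X 1 : MvPolynomial (Fin 3) k) - X 1 * (X 0 + 1) = X 0 ^ 3 by ring] at hmem
  have hmem := sub_mem h hX0
  rw [show (X 0 + 1 : MvPolynomial (Fin 3) k) - X 0 = 1 by ring] at hmem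
  exact hP.ne_top ((Ideal.eq_top_iff_one _).mpr hmem)

/-- The two chart certificates packaged over `c : Fin 2` in the engine's binder shape. -/
theorem hon (k : Type) [Field k] [CharP k 3] : ∀ (c : Fin 2)
    (Q' : Ideal (MvPolynomial (Fin 3) k ⧸ Ideal.span {(![1 + X 1 * X 2 ^ 2 + X 1 * X 2 ^ 3, X 0 ^ 3 + X 1 * X 0 + X 1] c :
      MvPolynomial (Fin 3) k)})) [Q'.IsMaximal],
    Ideal.Quotient.mk _ (X (Fan02of3.jc c)) ∈ Q' →
      ∀ d : ℕ, ringKrullDim (Localization.AtPrime Q') = d → ∀ s : Fin d → Localization.AtPrime Q',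
        (Ideal.span (Set.range s)).radical.IsMaximal →
          RingTheory.Sequence.IsWeaklyRegular (Localization.AtPrime Q') (List.ofFn s) ∧
          ∀ y : Localization.AtPrime Q', (∃ e : ℕ, y ^ 3 ^ e ∈ Ideal.span
            ((fun z : Localization.AtPrime Q' => z ^ 3 ^ e) ''
              (Ideal.span (Set.range s) : Set (Localization.AtPrime Q')))) → y ∈ Ideal.span (Set.range s) := by
  intro c Q' hQ' _
  fin_cases c
  · exact @hon₀ k _ _ Q' hQ'
  · exact @hon₁ k _ _ Q' hQ'

/-! ## §2 The base certificate (off) -/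

/-- **Off `V(y,t)` the surface `y³ + ut²y + ut³ = 0` satisfies the clause** at every maximal `Q ⊉ (ȳ, t̄)`: `t ∉ Q` (else `y³ ∈ Q`); if
`u ∉ Q` use `∂f/∂y = ut²`, if `u ∈ Q` then `y ∈ Q` and `∂f/∂u = t²y + t³ ∉ Q`. [folklore] -/
theorem hoff (k : Type) [Field k] [CharP k 3] (f : MvPolynomial (Fin 3) k)
    (hf : f = X 0 ^ 3 + X 1 * X 2 ^ 2 * X 0 + X 1 * X 2 ^ 3)
    (Q : Ideal (MvPolynomial (Fin 3) k ⧸ Ideal.span {f})) [Q.IsMaximal]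
    (hQ : ¬ Ideal.span {Ideal.Quotient.mk (Ideal.span {f}) (X 0), Ideal.Quotient.mk (Ideal.span {f}) (X 2)} ≤ Q) :
    ∀ d : ℕ, ringKrullDim (Localization.AtPrime Q) = d → ∀ s : Fin d → Localization.AtPrime Q,
      (Ideal.span (Set.range s)).radical.IsMaximal →
        RingTheory.Sequence.IsWeaklyRegular (Localization.AtPrime Q) (List.ofFn s) ∧
        ∀ y : Localization.AtPrime Q, (∃ e : ℕ, y ^ 3 ^ e ∈ Ideal.span
          ((fun z : Localization.AtPrime Q => z ^ 3 ^ e) ''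
            (Ideal.span (Set.range s) : Set (Localization.AtPrime Q)))) → y ∈ Ideal.span (Set.range s) := by
  haveI : Fact (Nat.Prime 3) := ⟨Nat.prime_three⟩
  have hP : (Q.comap (Ideal.Quotient.mk (Ideal.span {f}))).IsPrime := Ideal.comap_isPrime _ _
  have hfP := self_mem_comap f Q
  have hX2 : (X 2 : MvPolynomial (Fin 3) k) ∉ Q.comap (Ideal.Quotient.mk (Ideal.span {f})) := by
    intro h2
    have hX0 : (X 0 : MvPolynomial (Fin 3) k) ∈ Q.comap (Ideal.Quotient.mk (Ideal.span {f})) := by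
      refine hP.mem_of_pow_mem 3 ?_
      have hmem := sub_mem hfP (Ideal.mul_mem_right (X 1 * X 2 * X 0 + X 1 * X 2 ^ 2) _ h2)
      rwa [show f - X 2 * (X 1 * X 2 * X 0 + X 1 * X 2 ^ 2) = X 0 ^ 3 by rw [hf]; ring] at hmem
    refine hQ (Ideal.span_le.mpr ?_)
    rintro _ (rfl | rfl)
    · exact Ideal.mem_comap.mp hX0
    · exact Ideal.mem_comap.mp h2
  by_cases h1 : (X 1 : MvPolynomial (Fin 3) k) ∈ Q.comap (Ideal.Quotient.mk (Ideal.span {f}))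
  · -- `u ∈ Q`: then `y ∈ Q`, and `∂f/∂u = t²y + t³ ∉ Q`
    have hX0 : (X 0 : MvPolynomial (Fin 3) k) ∈ Q.comap (Ideal.Quotient.mk (Ideal.span {f})) := by
      refine hP.mem_of_pow_mem 3 ?_
      have hmem := sub_mem hfP (Ideal.mul_mem_right (X 2 ^ 2 * X 0 + X 2 ^ 3) _ h1)
      rwa [show f - X 1 * (X 2 ^ 2 * X 0 + X 2 ^ 3) = X 0 ^ 3 by rw [hf]; ring] at hmem
    refine ClauseOfPderivNotMem.stub_clauseOfPderivNotMem 3 k 3 f Q 1 ?_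
    rw [pderiv_one_f k f hf]
    intro h
    have hmem := sub_mem h (Ideal.mul_mem_left _ (X 2 ^ 2) hX0)
    rw [show (X 2 ^ 2 * X 0 + X 2 ^ 3 : MvPolynomial (Fin 3) k) - X 2 ^ 2 * X 0 = X 2 ^ 3 by ring] at hmem
    exact hX2 (hP.mem_of_pow_mem 3 hmem)
  · -- `u ∉ Q`: `∂f/∂y = ut² ∉ Q`
    refine ClauseOfPderivNotMem.stub_clauseOfPderivNotMem 3 k 3 f Q 0 ?_
    rw [pderiv_zero_f k f hf]
    intro h
    rcases hP.mem_or_mem h with h1' | h2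
    · exact h1 h1'
    · exact hX2 (hP.mem_of_pow_mem 2 h2)

/-! ## §3 #4β for the specimen -/

/-- **#4β FOR `X₁ = Spec k[y,u,t]/(y³ + ut²y + ut³)`, `char k = 3`, WITH CENTRE THE REDUCED SINGULAR LINE `(ȳ, t̄)`, AT EVERY POINT OF
`V(ȳ, t̄)`**: one call to `LineCentreEngine.closedCentreExists_of_charts`. [folklore mathematics; OURS as a certificate] -/
theorem closedCentreExists_AS3 (k : Type) [Field k] [CharP k 3] (f : MvPolynomial (Fin 3) k)
    (hf : f = X 0 ^ 3 + X 1 * X 2 ^ 2 * X 0 + X 1 * X 2 ^ 3)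
    (I : Ideal (MvPolynomial (Fin 3) k ⧸ Ideal.span {f}))
    (hI : I = Ideal.span {Ideal.Quotient.mk (Ideal.span {f}) (X 0), Ideal.Quotient.mk (Ideal.span {f}) (X 2)})
    (b : ↥(Spec (.of (MvPolynomial (Fin 3) k ⧸ Ideal.span {f})))) (hb : I ≤ b.asIdeal) :
    ∃ J : (Spec (.of (MvPolynomial (Fin 3) k ⧸ Ideal.span {f}))).IdealSheafData, J ≠ ⊥ ∧
      b ∈ (J.support : Set ↥(Spec (.of (MvPolynomial (Fin 3) k ⧸ Ideal.span {f})))) ∧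
      ∀ (X' : Scheme.{0}) (π : X' ⟶ Spec (.of (MvPolynomial (Fin 3) k ⧸ Ideal.span {f}))),
        Literature.AlgebraicGeometry.Resolution.IsBlowup π J →
        ∀ x' : X', π.base x' ∈ (J.support : Set ↥(Spec (.of (MvPolynomial (Fin 3) k ⧸ Ideal.span {f})))) →
          IsDomain (X'.presheaf.stalk x') ∧ ∀ d : ℕ, ringKrullDim (X'.presheaf.stalk x') = d →
            ∀ s : Fin d → X'.presheaf.stalk x', (Ideal.span (Set.range s)).radical.IsMaximal →
              RingTheory.Sequence.IsWeaklyRegular (X'.presheaf.stalk x') (List.ofFn s) ∧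
              ∀ z : X'.presheaf.stalk x', (∃ e : ℕ, z ^ 3 ^ e ∈
                  Ideal.span ((fun w : X'.presheaf.stalk x' => w ^ 3 ^ e) ''
                    (Ideal.span (Set.range s) : Set (X'.presheaf.stalk x')))) → z ∈ Ideal.span (Set.range s) := by
  haveI : Fact (Nat.Prime 3) := ⟨Nat.prime_three⟩
  exact LineCentreEngine.closedCentreExists_of_charts 3 k f (prime_AS3 k f hf).1 (fun c => (prime_AS3 k f hf).2 _)
    (fun _ => 3) ![1 + X 1 * X 2 ^ 2 + X 1 * X 2 ^ 3, X 0 ^ 3 + X 1 * X 0 + X 1] (theta k f hf) (hcop k) (hon k) (hoff k f hf)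
    I hI b hb

/-- **#4β FOR `X₁ = Spec k[y,u,t]/(y³ + ut²y + ut³)`, `char k = 3`, AT EVERY CLOSED BAD POINT** — the body of door v30's
`stub_closedCentreExists` for this `X₁`: one call to `LineCentreEngine.closedCentreExists_of_charts_bad`. [OURS as a certificate] -/
theorem closedCentreExists_AS3_bad (k : Type) [Field k] [CharP k 3] (f : MvPolynomial (Fin 3) k)
    (hf : f = X 0 ^ 3 + X 1 * X 2 ^ 2 * X 0 + X 1 * X 2 ^ 3)
    (b : ↥(Spec (.of (MvPolynomial (Fin 3) k ⧸ Ideal.span {f}))))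
    (hb : IsClosed ({b} : Set ↥(Spec (.of (MvPolynomial (Fin 3) k ⧸ Ideal.span {f})))))
    (hbad : ¬ ∀ d : ℕ, ringKrullDim ((Spec (.of (MvPolynomial (Fin 3) k ⧸ Ideal.span {f}))).presheaf.stalk b) = d →
      ∀ s : Fin d → (Spec (.of (MvPolynomial (Fin 3) k ⧸ Ideal.span {f}))).presheaf.stalk b,
        (Ideal.span (Set.range s)).radical.IsMaximal →
          ∀ y : (Spec (.of (MvPolynomial (Fin 3) k ⧸ Ideal.span {f}))).presheaf.stalk b, (∃ e : ℕ, y ^ 3 ^ e ∈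
            Ideal.span ((fun z : (Spec (.of (MvPolynomial (Fin 3) k ⧸ Ideal.span {f}))).presheaf.stalk b => z ^ 3 ^ e) ''
              (Ideal.span (Set.range s) : Set ((Spec (.of (MvPolynomial (Fin 3) k ⧸ Ideal.span {f}))).presheaf.stalk b)))) →
            y ∈ Ideal.span (Set.range s)) :
    ∃ J : (Spec (.of (MvPolynomial (Fin 3) k ⧸ Ideal.span {f}))).IdealSheafData, J ≠ ⊥ ∧
      b ∈ (J.support : Set ↥(Spec (.of (MvPolynomial (Fin 3) k ⧸ Ideal.span {f})))) ∧
      ∀ (X' : Scheme.{0}) (π : X' ⟶ Spec (.of (MvPolynomial (Fin 3) k ⧸ Ideal.span {f}))),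
        Literature.AlgebraicGeometry.Resolution.IsBlowup π J →
        ∀ x' : X', π.base x' ∈ (J.support : Set ↥(Spec (.of (MvPolynomial (Fin 3) k ⧸ Ideal.span {f})))) →
          IsDomain (X'.presheaf.stalk x') ∧ ∀ d : ℕ, ringKrullDim (X'.presheaf.stalk x') = d →
            ∀ s : Fin d → X'.presheaf.stalk x', (Ideal.span (Set.range s)).radical.IsMaximal →
              RingTheory.Sequence.IsWeaklyRegular (X'.presheaf.stalk x') (List.ofFn s) ∧
              ∀ z : X'.presheaf.stalk x', (∃ e : ℕ, z ^ 3 ^ e ∈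
                  Ideal.span ((fun w : X'.presheaf.stalk x' => w ^ 3 ^ e) ''
                    (Ideal.span (Set.range s) : Set (X'.presheaf.stalk x')))) → z ∈ Ideal.span (Set.range s) := by
  haveI : Fact (Nat.Prime 3) := ⟨Nat.prime_three⟩
  exact LineCentreEngine.closedCentreExists_of_charts_bad 3 k f (prime_AS3 k f hf).1 (fun c => (prime_AS3 k f hf).2 _)
    (fun _ => 3) ![1 + X 1 * X 2 ^ 2 + X 1 * X 2 ^ 3, X 0 ^ 3 + X 1 * X 0 + X 1] (theta k f hf) (hcop k) (hon k) (hoff k f hf)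
    b hb hbad

end Summit.ResolutionOfSingularities.ResolutionOfSingularities.Theorems.FInjectiveMacaulayfication.AS3Pinch
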